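import Mathlib
import Summits.Ventures.PercRepro2.PMK5Deg3Kernel
import Summits.Ventures.PercRepro2.Deg3Conn
import Summits.Ventures.PercRepro2.Deg3Typed
import Summits.Ventures.PercRepro2.PMK5Deg3CertOA1A2
import Summits.Ventures.PercRepro2.PMK5Deg3CertOA1U
import Summits.Ventures.PercRepro2.PMK5Deg3CertOA1B
import Summits.Ventures.PercRepro2.PMK5Deg3CertOA2U
import Summits.Ventures.PercRepro2.PMK5Deg3CertOA2B
import Summits.Ventures.PercRepro2.PMK5Deg3CertOUB
import Summits.Ventures.PercRepro2.PMK5Deg3CertA1A2U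
import Summits.Ventures.PercRepro2.PMK5Deg3CertA1A2B
import Summits.Ventures.PercRepro2.PMK5Deg3CertA1UB
import Summits.Ventures.PercRepro2.PMK5Deg3CertA2UB

/-!
# THEOREM 28 — THE WHOLE DEGREE-3 FAMILY: ROW 2′TRI AND (HCOV) ON `K₅ + {a₃x, a₃y, a₃z}` FOR ALL TEN ATTACHMENT TRIPLES
(blind cell PercRepro2, mine-2 g27)

The ten triples' certificates (`PMK5Deg3Cert*.lean`: seventy-six kernel-certified table literals and sixteen
slice certificates each) and the parametrised bridge `Deg3Typed.HCov_deg3` give, for every triple `x < y < z`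
of vertices of the five-vertex base `K₅(o, a₁, a₂, u, b)` and the mark `a₃` joined to all three:
**`typedBases_all`** — row 2′TRI (`CovForm.TypedBases (ends13 x y z) 0 1 2 5 4`) — and **`HCov_deg3_all`** —
(HCOV) for every probability vector `p : Fin 13 → R`.  With Theorems 14 / 16 / 27 this closes (HCOV) in the
kernel on every six-vertex graph in which the five marks sit on a five-vertex base and the sixth vertex `a₃`
has degree `≤ 3` into it (missing edges at weight `0`).  Standard axioms only.
-/

namespace Summit.Ventures.PercRepro2

namespace Deg3

variable {R : Type*} [Field R] [LinearOrder R] [IsStrictOrderedRing R]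

/-- **THEOREM 28 (typed form): row 2′TRI on every `K₅ + {a₃x, a₃y, a₃z}`, `x < y < z`.** -/
theorem typedBases_all (x y z : Fin 5) (hxy : x < y) (hyz : y < z) :
    CovForm.TypedBases (R := R) (ends13 x y z) 0 1 2 5 4 := by
  fin_cases x <;> fin_cases y <;> fin_cases z <;>
    first | exact absurd hxy (by decide) | exact absurd hyz (by decide) | skip
  · exact typedBases_oa1a2
  · exact typedBases_oa1u
  · exact typedBases_oa1b
  · exact typedBases_oa2u
  · exact typedBases_oa2b
  · exact typedBases_oub
  · exact typedBases_a1a2u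
  · exact typedBases_a1a2b
  · exact typedBases_a1ub
  · exact typedBases_a2ub

/-- **THEOREM 28: (HCOV) on every `K₅ + {a₃x, a₃y, a₃z}`, `x < y < z`, for every weight vector.** -/
theorem HCov_deg3_all (x y z : Fin 5) (hxy : x < y) (hyz : y < z) (p : Fin 13 → R) (hp : IsProbVec p) :
    CovForm.HCov p (ends13 x y z) 0 1 2 5 4 := by
  fin_cases x <;> fin_cases y <;> fin_cases z <;>
    first | exact absurd hxy (by decide) | exact absurd hyz (by decide) | skip
  · exact HCov_deg3_oa1a2 p hp
  · exact HCov_deg3_oa1u p hp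
  · exact HCov_deg3_oa1b p hp
  · exact HCov_deg3_oa2u p hp
  · exact HCov_deg3_oa2b p hp
  · exact HCov_deg3_oub p hp
  · exact HCov_deg3_a1a2u p hp
  · exact HCov_deg3_a1a2b p hp
  · exact HCov_deg3_a1ub p hp
  · exact HCov_deg3_a2ub p hp

end Deg3

end Summit.Ventures.PercRepro2
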